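import Literature.NumberTheory.LFunctions.YoshidaWindowGramTailJBox
import HarnessLib

/-!
# Kernel enclosures of Yoshida's matrix coefficients — VII-c: the odd order-`J` tail box and the door's `hS` enclosures

Source: H. Yoshida, Adv. Stud. Pure Math. **21** (1992) 281–325, §§6–7 [Yoshida1992HermitianForms].  Kernel
enclosures (`MI` boxes at scale `S`) of the order-`J` tail matrices `U₂⁺`, `U₂⁻` of
`WeilFormatC.weilPositivityOn_of_formatC_dataJ` (part VII-a: `Encl.U2EvenJ`, `Encl.U2OddJ`), built from the constants
record, the front-door constants (part V) and the special-value table (even box: part VII-b).  This file: the odd atoms'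
boxes and `Encl.u2OddJBox` with `mem_u2OddJBox` (`θ = θn/θd`, `η = ηn/ηd`, `d₀ = d0z·2^{−cd}`), and the packaging of the door's
`hS` hypotheses in their exact shape from the row-band kernel checks: `Encl.even_front_nearJ` (constant column
weight, `checkFrontRowsAux` over the light-table column list) and `Encl.odd_front_nearJW` (weight list,
`checkFrontRowsAuxW`).  Everything is proved; no named facts.
-/

open Real Complex Finset Matrix
open scoped BigOperators

namespace Literature.NumberTheory.LFunctions.Yoshida1992

open Literature.Analysis.SpecialFunctions Literature.Analysis.ValidatedNumerics.NumericsMP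
open Literature.Analysis.ValidatedNumerics
open scoped ArithmeticFunction.vonMangoldt

namespace Encl

variable {S : ℕ} {a : ℝ} {prm : Params} {ks : List PrimeLen} {C : Consts} {tab ctab : List IdxRec}

/-! ## Boxes of the odd atoms and of `U₂⁻` -/

/-- box of `C_A⁻`. [cite: Moore1966, Ch. 3 (interval arithmetic: inclusion property)] -/
def cAoBox (S : ℕ) (C : Consts) (F : FDConsts) (B3o : ℕ) : MI :=
  ((C.P.divNat 4).add F.A1).add ((F.Ca.mul S C.invPi).divNat (B3o + 1))

/-- [cite: Moore1966, Ch. 3 (interval arithmetic: inclusion property)] -/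
theorem mem_cAoBox (hS : 0 < S) (hC : ConstsValid S a ks C) {F : FDConsts} (hF : FDValid S a F) (B3o : ℕ) :
    MI.mem S (cAo a B3o) (cAoBox S C F B3o) := by
  unfold cAo cAoBox
  have h := MI.mem_add (MI.mem_add (MI.mem_divNat hC.pi (n := 4) (by norm_num)) hF.A1)
    (MI.mem_divNat (MI.mem_mul hS hF.Ca hC.invPi) (n := B3o + 1) (by omega))
  refine mem_of_eq h ?_
  have hπ : (π : ℝ) ≠ 0 := Real.pi_ne_zero
  have hB' : (B3o : ℝ) + 1 ≠ 0 := by positivity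
  push_cast
  field_simp

/-- box of `v^A_j(k)` (odd; an integer). [cite: Moore1966, Ch. 3 (interval arithmetic: inclusion property)] -/
def vAoBox (S : ℕ) (k j : ℕ) : MI := MI.ofInt S ((-1) ^ (k + 1) * ((k : ℤ) + 1) ^ (2 * j + 1))

/-- [cite: Moore1966, Ch. 3 (interval arithmetic: inclusion property)] -/
theorem mem_vAoBox (S : ℕ) (k j : ℕ) : MI.mem S (vAo k j) (vAoBox S k j) := by
  unfold vAo vAoBox
  refine mem_of_eq (MI.mem_ofInt S _) ?_
  push_cast; ring

/-- box of `v^B_r(k)` (odd) from the record at mode `k + 1`. [cite: Moore1966, Ch. 3 (interval arithmetic: inclusion property)] -/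
def vBoBox (S : ℕ) (C : Consts) (F : FDConsts) (R : IdxRec) (k r : ℕ) : MI :=
  (MI.ofInt S ((-1) ^ (k + 1))).mul S
    ((((MI.ofInt S (-(((k : ℤ) + 1) ^ (2 * r)))).mul S (modeFBox S C R)).mul S C.invPi).sub
      (((((F.s2.mulInt 4).mul S C.invPi).mul S (MI.ofInt S ((-1) ^ r))).mul S (powBox S (qqBox S C F) r)).mul S
        (R.om.mul S R.c)))

/-- [cite: Moore1966, Ch. 3 (interval arithmetic: inclusion property)] -/
theorem mem_vBoBox (hS : 0 < S) (hks : PrimeData a ks) (hC : ConstsValid S a ks C) {F : FDConsts} (hF : FDValid S a F)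
    {k r : ℕ} {R : IdxRec} (hR : OffValid S a ks ((k : ℤ) + 1) R) : MI.mem S (vBo a k r) (vBoBox S C F R k r) := by
  unfold vBo vBoBox s2r wcoef
  have hq := mem_powBox hS (mem_qqBox hS hC hF) r
  have h := MI.mem_mul hS (MI.mem_ofInt S ((-1) ^ (k + 1)))
    (MI.mem_sub (MI.mem_mul hS (MI.mem_mul hS (MI.mem_ofInt S (-(((k : ℤ) + 1) ^ (2 * r)))) (mem_modeFBox hS hks hC hR))
      hC.invPi)
      (MI.mem_mul hS (MI.mem_mul hS (MI.mem_mul hS (MI.mem_mul hS (MI.mem_mulInt hF.s2 4) hC.invPi)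
        (MI.mem_ofInt S ((-1) ^ r))) hq) (MI.mem_mul hS hR.om hR.c)))
  refine mem_of_eq h ?_
  push_cast; ring

/-- box of `ρ⁻_k` from the record at mode `k + 1`. [cite: Moore1966, Ch. 3 (interval arithmetic: inclusion property)] -/
def rhoOBox (S : ℕ) (C : Consts) (F : FDConsts) (R : IdxRec) (Jo k : ℕ) : MI :=
  (((cFBox S C F).mulInt (2 * ((k : ℤ) + 1) ^ (2 * Jo))).mul S C.invPi).add
    ((((F.s2.mulInt 4).mul S C.invPi).mul S (powBox S (qqBox S C F) Jo)).mul S (R.om.mul S R.c))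

/-- [cite: Moore1966, Ch. 3 (interval arithmetic: inclusion property)] -/
theorem mem_rhoOBox (hS : 0 < S) (hC : ConstsValid S a ks C) {F : FDConsts} (hF : FDValid S a F)
    {Jo k : ℕ} {R : IdxRec} (hR : OffValid S a ks ((k : ℤ) + 1) R) : MI.mem S (rhoO a Jo k) (rhoOBox S C F R Jo k) := by
  unfold rhoO rhoOBox s2r wcoef
  have hq := mem_powBox hS (mem_qqBox hS hC hF) Jo
  have h := MI.mem_add (MI.mem_mul hS (MI.mem_mulInt (mem_cFBox hS hC hF) (2 * ((k : ℤ) + 1) ^ (2 * Jo))) hC.invPi)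
    (MI.mem_mul hS (MI.mem_mul hS (MI.mem_mul hS (MI.mem_mulInt hF.s2 4) hC.invPi) hq) (MI.mem_mul hS hR.om hR.c))
  refine mem_of_eq h ?_
  push_cast; ring

/-- **Kernel box of `U₂⁻(k,k')`** for the order-`J` door (records at modes `k+1`, `k'+1`).
[cite: Yoshida1992HermitianForms, §7 pp. 305–312] -/
def u2OddJBox (S : ℕ) (C : Consts) (F : FDConsts) (tab : List IdxRec) (cd d0z Bo B3o Jo θn θd ηn ηd : ℕ)
    (k k' : ℕ) : MI :=
  let cA := ((((cAoBox S C F B3o).sqr S).mul S F.invPi2).mulInt (((θd + θn) * (ηd + ηn) * 2 ^ cd : ℕ) : ℤ)).divNat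
    (θd * ηd * d0z)
  let tA := sumBox S (fun j ↦ sumBox S (fun j' ↦
    ((hankHBox S pOA B3o (B3o + 1) Bo Jo j j').mul S (vAoBox S k j)).mul S (vAoBox S k' j')) Jo) Jo
  let cB := ((MI.ofInt S 1).mulInt (((θd + θn) * (ηn + ηd) * 2 ^ cd : ℕ) : ℤ)).divNat (θd * ηn * d0z)
  let tB := sumBox S (fun r ↦ sumBox S (fun r' ↦
    ((hankHBox S pOB B3o (B3o + 1) Bo Jo r r').mul S (vBoBox S C F (tget tab (k + 1)) k r)).mul S
      (vBoBox S C F (tget tab (k' + 1)) k' r')) Jo) Jo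
  let t := (cA.mul S tA).add (cB.mul S tB)
  if k = k' then
    t.add ((((MI.ofInt S 1).mulInt (((θn + θd) * Bo * 2 ^ cd : ℕ) : ℤ)).divNat
      (θn * d0z * (4 * Jo + 1) * B3o ^ (4 * Jo + 1))).mul S ((rhoOBox S C F (tget tab (k + 1)) Jo k).sqr S))
  else t

/-- **`u2OddJBox ∋ U₂⁻(k,k')`** (table valid below `N`, `k+1, k'+1 < N`). [cite: Yoshida1992HermitianForms, §7 pp. 305–312] -/
theorem mem_u2OddJBox (hS : 0 < S) (hks : PrimeData a ks) (hC : ConstsValid S a ks C) {F : FDConsts}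
    (hF : FDValid S a F) {tab : List IdxRec} {N : ℕ} (hT : TabValid S a ks N tab)
    {cd d0z Bo B3o Jo θn θd ηn ηd : ℕ} (hd0 : 0 < d0z) (hθn : 0 < θn) (hθd : 0 < θd) (hηn : 0 < ηn) (hηd : 0 < ηd)
    (hBo : 0 < Bo) (hB3 : 1 ≤ B3o) {k k' : ℕ} (hk : k + 1 < N) (hk' : k' + 1 < N) :
    MI.mem S (U2OddJ a ((θn : ℝ) / θd) ((ηn : ℝ) / ηd) ((d0z : ℝ) * (1 / 2 ^ cd)) Bo B3o Jo k k')
      (u2OddJBox S C F tab cd d0z Bo B3o Jo θn θd ηn ηd k k') := by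
  rw [← U2OddJ'_eq]
  have ek : (((k + 1 : ℕ) : ℤ)) = (k : ℤ) + 1 := by push_cast; ring
  have ek' : (((k' + 1 : ℕ) : ℤ)) = (k' : ℤ) + 1 := by push_cast; ring
  have hRk : OffValid S a ks ((k : ℤ) + 1) (tget tab (k + 1)) := by
    have h := (hT (k + 1) hk).1; rwa [ek] at h
  have hRk' : OffValid S a ks ((k' : ℤ) + 1) (tget tab (k' + 1)) := by
    have h := (hT (k' + 1) hk').1; rwa [ek'] at h
  have hπ : (π : ℝ) ≠ 0 := Real.pi_ne_zero
  have hθd' : (θd : ℝ) ≠ 0 := by exact_mod_cast hθd.ne'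
  have hθn' : (θn : ℝ) ≠ 0 := by exact_mod_cast hθn.ne'
  have hηd' : (ηd : ℝ) ≠ 0 := by exact_mod_cast hηd.ne'
  have hηn' : (ηn : ℝ) ≠ 0 := by exact_mod_cast hηn.ne'
  have hd0' : (d0z : ℝ) ≠ 0 := by exact_mod_cast hd0.ne'
  have h2 : (2 : ℝ) ^ cd ≠ 0 := by positivity
  have hpA : ∀ j, 1 ≤ pOA j := fun j ↦ by simp [pOA]
  have hpB : ∀ j, 1 ≤ pOB j := fun j ↦ by simp [pOB]
  have hcA : MI.mem S ((1 + (θn : ℝ) / θd) * (1 + (ηn : ℝ) / ηd) * (cAo a B3o ^ 2 / (π ^ 2 * ((d0z : ℝ) * (1 / 2 ^ cd)))))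
      (((((cAoBox S C F B3o).sqr S).mul S F.invPi2).mulInt (((θd + θn) * (ηd + ηn) * 2 ^ cd : ℕ) : ℤ)).divNat
        (θd * ηd * d0z)) := by
    have h := MI.mem_divNat (MI.mem_mulInt (MI.mem_mul hS (MI.mem_sqr hS (mem_cAoBox hS hC hF B3o))
      hF.invPi2) (((θd + θn) * (ηd + ηn) * 2 ^ cd : ℕ) : ℤ)) (n := θd * ηd * d0z) (by positivity)
    refine mem_of_eq h ?_
    push_cast
    field_simp
  have hcB : MI.mem S ((1 + (θn : ℝ) / θd) * (1 + ((ηn : ℝ) / ηd)⁻¹) * (1 / ((d0z : ℝ) * (1 / 2 ^ cd))))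
      (((MI.ofInt S 1).mulInt (((θd + θn) * (ηn + ηd) * 2 ^ cd : ℕ) : ℤ)).divNat (θd * ηn * d0z)) := by
    have h := MI.mem_divNat (MI.mem_mulInt (MI.mem_ofInt S 1) (((θd + θn) * (ηn + ηd) * 2 ^ cd : ℕ) : ℤ))
      (n := θd * ηn * d0z) (by positivity)
    refine mem_of_eq h ?_
    push_cast
    field_simp
  have hcR : MI.mem S ((1 + ((θn : ℝ) / θd)⁻¹) * ((Bo : ℝ) / ((d0z : ℝ) * (1 / 2 ^ cd) *
      ((4 * Jo + 1 : ℕ) * (B3o : ℝ) ^ (4 * Jo + 1)))))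
      (((MI.ofInt S 1).mulInt (((θn + θd) * Bo * 2 ^ cd : ℕ) : ℤ)).divNat
        (θn * d0z * (4 * Jo + 1) * B3o ^ (4 * Jo + 1))) := by
    have h := MI.mem_divNat (MI.mem_mulInt (MI.mem_ofInt S 1) (((θn + θd) * Bo * 2 ^ cd : ℕ) : ℤ))
      (n := θn * d0z * (4 * Jo + 1) * B3o ^ (4 * Jo + 1)) (by positivity)
    refine mem_of_eq h ?_
    have hX' : (B3o : ℝ) ≠ 0 := by exact_mod_cast (show B3o ≠ 0 by omega)
    push_cast
    field_simp
  have htA : MI.mem S (∑ j ∈ Finset.range Jo, ∑ j' ∈ Finset.range Jo,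
      hankH pOA B3o (B3o + 1) Bo Jo j j' * vAo k j * vAo k' j')
      (sumBox S (fun j ↦ sumBox S (fun j' ↦
        ((hankHBox S pOA B3o (B3o + 1) Bo Jo j j').mul S (vAoBox S k j)).mul S (vAoBox S k' j')) Jo) Jo) :=
    mem_sumBox S Jo fun j _ ↦ mem_sumBox S Jo fun j' _ ↦
      MI.mem_mul hS (MI.mem_mul hS (mem_hankHBox S hpA (by omega) (by omega) hBo j j') (mem_vAoBox S k j))
        (mem_vAoBox S k' j')
  have htB : MI.mem S (∑ r ∈ Finset.range Jo, ∑ r' ∈ Finset.range Jo,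
      hankH pOB B3o (B3o + 1) Bo Jo r r' * vBo a k r * vBo a k' r')
      (sumBox S (fun r ↦ sumBox S (fun r' ↦
        ((hankHBox S pOB B3o (B3o + 1) Bo Jo r r').mul S (vBoBox S C F (tget tab (k + 1)) k r)).mul S
          (vBoBox S C F (tget tab (k' + 1)) k' r')) Jo) Jo) :=
    mem_sumBox S Jo fun r _ ↦ mem_sumBox S Jo fun r' _ ↦
      MI.mem_mul hS (MI.mem_mul hS (mem_hankHBox S hpB (by omega) (by omega) hBo r r') (mem_vBoBox hS hks hC hF hRk))
        (mem_vBoBox hS hks hC hF hRk')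
  have ht := MI.mem_add (MI.mem_mul hS hcA htA) (MI.mem_mul hS hcB htB)
  unfold U2OddJ' u2OddJBox
  simp only
  by_cases hkk : k = k'
  · subst hkk
    simp only [if_true]
    exact MI.mem_add ht (MI.mem_mul hS hcR (MI.mem_sqr hS (mem_rhoOBox hS hC hF hRk)))
  · simp only [hkk, if_false, add_zero]
    exact ht


/-! ## Packaging: the order-`J` door's `hS` hypotheses, verbatim, from the kernel checks -/

/-- The even front-door entry with an arbitrary tail matrix `U₂` equals `frontEntry`.
[cite: Yoshida1992HermitianForms, §7 pp. 305–312] -/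
theorem even_entry_eq_frontEntry_gen (a : ℝ) (Be B3e : ℕ) (cd wz : ℕ) (U₂ : ℕ → ℕ → ℝ) (i j : Fin Be) :
    ((if (i : ℕ) = 0 then gramCoeff a 0 j else if (j : ℕ) = 0 then gramCoeff a i 0
        else (gramCoeff a i j + gramCoeff a i (-(j : ℤ))) / 2)
      - (∑ m ∈ Finset.Ico Be B3e, (if (i : ℕ) = 0 then gramCoeff a 0 m else if m = 0 then gramCoeff a i 0
          else (gramCoeff a i m + gramCoeff a i (-(m : ℤ))) / 2) *
          (if (j : ℕ) = 0 then gramCoeff a 0 m else if m = 0 then gramCoeff a j 0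
          else (gramCoeff a j m + gramCoeff a j (-(m : ℤ))) / 2) / ((fun _ : ℕ ↦ (wz : ℝ) * (1 / 2 ^ cd)) m))
      - U₂ i j)
    = frontEntry (sectorKernel false (gramCoeff a)) Be (B3e - Be) cd wz U₂ i j := by
  unfold frontEntry
  simp only [sectorKernel, evenKernel, Bool.false_eq_true, if_false]
  congr 1
  congr 1
  rw [Finset.sum_Ico_eq_sum_range]

/-- The odd front-door entry (weight list) with an arbitrary tail matrix `U₂` equals `frontEntryW`.
[cite: Yoshida1992HermitianForms, §7 pp. 305–312] -/
theorem odd_entry_eq_frontEntryW_gen (a : ℝ) (Bo B3o : ℕ) (cd : ℕ) (ws : List ℕ) (U₂ : ℕ → ℕ → ℝ) (k k' : Fin Bo) :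
    ((((gramCoeff a (((k : ℕ) : ℤ) + 1) (((k' : ℕ) : ℤ) + 1) - gramCoeff a (((k : ℕ) : ℤ) + 1) (-(((k' : ℕ) : ℤ) + 1))) / 2)
      - (∑ l ∈ Finset.Ico Bo B3o, ((gramCoeff a (((k : ℕ) : ℤ) + 1) ((l : ℤ) + 1) - gramCoeff a (((k : ℕ) : ℤ) + 1) (-((l : ℤ) + 1))) / 2) *
          ((gramCoeff a (((k' : ℕ) : ℤ) + 1) ((l : ℤ) + 1) - gramCoeff a (((k' : ℕ) : ℤ) + 1) (-((l : ℤ) + 1))) / 2) /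
            (woF ws cd Bo l))
      - U₂ k k'))
    = frontEntryW (sectorKernel true (gramCoeff a)) Bo (B3o - Bo) cd ws U₂ k k' := by
  unfold frontEntryW
  simp only [sectorKernel, oddKernel, if_true]
  congr 1
  congr 1
  rw [Finset.sum_Ico_eq_sum_range]

/-- **EVEN `hS` of the order-`J` door** from the kernel checks (light-table column list, constant weight
`w = wz·2^{−cd}`, tail box `u2EvenJBox`, Schur-row check against `DS` on the row band `[i0, i0+k)`).
[cite: Yoshida1992HermitianForms, §7 pp. 305–312] -/
theorem even_front_nearJ (hS : 0 < S) (ha0 : 0 < a) (hks : PrimeData a ks) (hC : ConstsValid S a ks C)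
    {F : FDConsts} (hF : FDValid S a F) {tab ctab : List IdxRec} {Be B3e : ℕ} (hBe : 1 ≤ Be) (hBB : Be ≤ B3e)
    (hB3 : 2 ≤ B3e) (hT : TabValid S a ks (Be + 1) tab) (hCT : TabColValid S a ks Be (B3e + 1) ctab)
    {c cd wz d0z Je θn θd ηn ηd : ℕ} (hd0 : 0 < d0z) (hθn : 0 < θn) (hθd : 0 < θd) (hηn : 0 < ηn) (hηd : 0 < ηd)
    {ρS : ℤ} {DS : List (List ℤ)} {i0 k : ℕ}
    (h : checkFrontRowsAux S c ρS C tab false Be (colList false S C tab ctab Be (B3e - Be)) cd wz (B3e - Be)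
      (u2EvenJBox S C F tab cd d0z Be B3e Je θn θd ηn ηd) DS i0 k = true)
    (i j : Fin Be) (hi : i0 ≤ i) (hik : (i : ℕ) < i0 + k) :
    |((if (i : ℕ) = 0 then gramCoeff a 0 j else if (j : ℕ) = 0 then gramCoeff a i 0
        else (gramCoeff a i j + gramCoeff a i (-(j : ℤ))) / 2)
      - (∑ m ∈ Finset.Ico Be B3e, (if (i : ℕ) = 0 then gramCoeff a 0 m else if m = 0 then gramCoeff a i 0
          else (gramCoeff a i m + gramCoeff a i (-(m : ℤ))) / 2) *
          (if (j : ℕ) = 0 then gramCoeff a 0 m else if m = 0 then gramCoeff a j 0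
          else (gramCoeff a j m + gramCoeff a j (-(m : ℤ))) / 2) / ((fun _ : ℕ ↦ (wz : ℝ) * (1 / 2 ^ cd)) m))
      - U2EvenJ a ((θn : ℝ) / θd) ((ηn : ℝ) / ηd) ((d0z : ℝ) * (1 / 2 ^ cd)) Be B3e Je i j)
      - (PsdDyadic.getMZ DS i j : ℝ) * (1 / 2 ^ c)| ≤ (ρS : ℝ) * (1 / 2 ^ c) := by
  rw [even_entry_eq_frontEntry_gen a Be B3e cd wz
    (fun i j ↦ U2EvenJ a ((θn : ℝ) / θd) ((ηn : ℝ) / ηd) ((d0z : ℝ) * (1 / 2 ^ cd)) Be B3e Je i j) i j]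
  have hcols := colsValid_colList hS ha0 hks hC hBe hT (K := B3e - Be)
    (by rw [Nat.add_sub_cancel' hBB]; exact hCT) false
  exact near_front_of_checkAux hS ha0 hks hC hT hcols
    (fun i hi j hj ↦ mem_u2EvenJBox hS hks hC hF hT hd0 hθn hθd hηn hηd (by omega) hB3 (by omega) (by omega))
    h hi hik i.isLt j.isLt

/-- **ODD `hS` of the order-`J` door with per-column weights** (`wo l = ws_{l−B}·2^{−cd}`, tail box `u2OddJBox`).
[cite: Yoshida1992HermitianForms, §7 pp. 305–312] -/
theorem odd_front_nearJW (hS : 0 < S) (ha0 : 0 < a) (hks : PrimeData a ks) (hC : ConstsValid S a ks C)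
    {F : FDConsts} (hF : FDValid S a F) {tab ctab : List IdxRec} {Bo B3o : ℕ} (hBo : 1 ≤ Bo) (hBB : Bo ≤ B3o)
    (hT : TabValid S a ks (Bo + 1) tab) (hCT : TabColValid S a ks Bo (B3o + 1) ctab)
    {c cd d0z Jo θn θd ηn ηd : ℕ} {ws : List ℕ} (hd0 : 0 < d0z) (hθn : 0 < θn) (hθd : 0 < θd) (hηn : 0 < ηn)
    (hηd : 0 < ηd) {ρS : ℤ} {DS : List (List ℤ)} {i0 k : ℕ}
    (h : checkFrontRowsAuxW S c ρS C tab true Bo (colList true S C tab ctab Bo (B3o - Bo)) cd ws (B3o - Bo)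
      (u2OddJBox S C F tab cd d0z Bo B3o Jo θn θd ηn ηd) DS i0 k = true)
    (kk kk' : Fin Bo) (hi : i0 ≤ kk) (hik : (kk : ℕ) < i0 + k) :
    |(((gramCoeff a (((kk : ℕ) : ℤ) + 1) (((kk' : ℕ) : ℤ) + 1) - gramCoeff a (((kk : ℕ) : ℤ) + 1) (-(((kk' : ℕ) : ℤ) + 1))) / 2)
      - (∑ l ∈ Finset.Ico Bo B3o, ((gramCoeff a (((kk : ℕ) : ℤ) + 1) ((l : ℤ) + 1) - gramCoeff a (((kk : ℕ) : ℤ) + 1) (-((l : ℤ) + 1))) / 2) *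
          ((gramCoeff a (((kk' : ℕ) : ℤ) + 1) ((l : ℤ) + 1) - gramCoeff a (((kk' : ℕ) : ℤ) + 1) (-((l : ℤ) + 1))) / 2) /
            (woF ws cd Bo l))
      - U2OddJ a ((θn : ℝ) / θd) ((ηn : ℝ) / ηd) ((d0z : ℝ) * (1 / 2 ^ cd)) Bo B3o Jo kk kk')
      - (PsdDyadic.getMZ DS kk kk' : ℝ) * (1 / 2 ^ c)| ≤ (ρS : ℝ) * (1 / 2 ^ c) := by
  rw [odd_entry_eq_frontEntryW_gen a Bo B3o cd ws
    (fun k k' ↦ U2OddJ a ((θn : ℝ) / θd) ((ηn : ℝ) / ηd) ((d0z : ℝ) * (1 / 2 ^ cd)) Bo B3o Jo k k') kk kk']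
  have hcols := colsValid_colList hS ha0 hks hC hBo hT (K := B3o - Bo)
    (by rw [Nat.add_sub_cancel' hBB]; exact hCT) true
  exact near_front_of_checkAuxW hS ha0 hks hC hT hcols
    (fun i hi j hj ↦ mem_u2OddJBox hS hks hC hF hT hd0 hθn hθd hηn hηd (by omega) (by omega) (by omega) (by omega))
    h hi hik kk.isLt kk'.isLt

end Encl

end Literature.NumberTheory.LFunctions.Yoshida1992
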